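import Literature.MathematicalPhysics.QuantumLattice.FinDimSpectrumGibbsLimitProofs
import Literature.MathematicalPhysics.QuantumLattice.XYOrderGDProofs
import Literature.MathematicalPhysics.QuantumLattice.RayleighBottom

/-!
# Route `AnisotropyChord`, support `SectorAnchorXY` (stmt-HubbardSuperconductivity-0977) — part 1:
# second-order stability of the ground-state energy under a ground-space-blind perturbation

Abstract finite-dimensional linear algebra for the sector identification of the KLS anchor.

* `exists_gap_posSemidef` — **the spectral gap as an operator inequality**: for Hermitian `H` with
  ground energy `E₀` and ground projection `P₀` there is `g > 0` with `H - E₀ - g (1 - P₀) ≥ 0`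
  (`g` = distance from `E₀` to the rest of the spectrum, or `1` if `H = E₀`).
* `le_groundEnergy_sub_smul_diagonal` — **second-order lower bound**: if a bounded real diagonal
  perturbation `D` has vanishing expectation in every ground vector of `H` (`⟨v, D v⟩ = 0` on the
  ground space), then `E₀(H - μD) ≥ E₀(H) - C μ²` for all real `μ`, with `C = 9B²/(4g)`: in a unit
  ground vector `φ` of `H - μD` split `φ = P₀φ + w`; the gap gives `⟨φ,Hφ⟩ ≥ E₀ + g‖w‖²`, the
  blindness and Cauchy–Schwarz give `|⟨φ,Dφ⟩| ≤ 3B‖w‖`, and `g t² - 3|μ|B t ≥ -9μ²B²/(4g)`.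
Folklore (first-order perturbation theory for a degenerate level, Kato; Reed–Simon IV §XII.1);
no definition is introduced.
-/

-- the mandated namespace `Summit.<Summit>.<Problem>.Theorems` repeats `HubbardSuperconductivity`
set_option linter.dupNamespace false

noncomputable section

namespace Summit.HubbardSuperconductivity.HubbardSuperconductivity.Theorems.AnisotropyChord

open Matrix Finset Literature.MathematicalPhysics.QuantumLattice
open scoped ComplexOrder

variable {m : Type*} [Fintype m] [DecidableEq m]

/-! ### Small vector algebra -/

/-- **Cauchy–Schwarz for a bounded real diagonal form**: if `|xᵢ| ≤ B` then
`‖⟨u, diag(x) w⟩‖ ≤ B √(Re⟨u,u⟩) √(Re⟨w,w⟩)`. [folklore] -/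
theorem norm_dotProduct_diagonal_mulVec_le (x : m → ℝ) {B : ℝ} (hB : ∀ i, |x i| ≤ B)
    (u w : m → ℂ) :
    ‖star u ⬝ᵥ (diagonal (fun i => ((x i : ℝ) : ℂ)) *ᵥ w)‖ ≤
      B * Real.sqrt ((star u ⬝ᵥ u).re) * Real.sqrt ((star w ⬝ᵥ w).re) := by
  rcases isEmpty_or_nonempty m with hm | ⟨⟨i₀⟩⟩
  · simp [dotProduct]
  have hB0 : 0 ≤ B := (abs_nonneg _).trans (hB i₀)
  rw [RayleighBottom.re_star_dotProduct_self, RayleighBottom.re_star_dotProduct_self]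
  calc ‖star u ⬝ᵥ (diagonal (fun i => ((x i : ℝ) : ℂ)) *ᵥ w)‖
      = ‖∑ i, star (u i) * ((x i : ℂ) * w i)‖ := by
        simp only [dotProduct, mulVec_diagonal, Pi.star_apply]
    _ ≤ ∑ i, ‖star (u i) * ((x i : ℂ) * w i)‖ := norm_sum_le _ _
    _ = ∑ i, |x i| * (‖u i‖ * ‖w i‖) := by
        refine sum_congr rfl fun i _ => ?_
        rw [norm_mul, norm_mul, norm_star, Complex.norm_real, Real.norm_eq_abs]
        ring
    _ ≤ ∑ i, B * (‖u i‖ * ‖w i‖) :=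
        sum_le_sum fun i _ => mul_le_mul_of_nonneg_right (hB i) (by positivity)
    _ = B * ∑ i, ‖u i‖ * ‖w i‖ := by rw [mul_sum]
    _ ≤ B * (Real.sqrt (∑ i, ‖u i‖ ^ 2) * Real.sqrt (∑ i, ‖w i‖ ^ 2)) := by
        refine mul_le_mul_of_nonneg_left ?_ hB0
        have hcs := sum_mul_sq_le_sq_mul_sq (univ : Finset m) (fun i => ‖u i‖) (fun i => ‖w i‖)
        have h0 : 0 ≤ ∑ i, ‖u i‖ * ‖w i‖ := sum_nonneg fun i _ => by positivity
        rw [← Real.sqrt_mul (sum_nonneg fun i _ => by positivity), ← Real.sqrt_sq h0]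
        exact Real.sqrt_le_sqrt hcs
    _ = B * Real.sqrt (∑ i, ‖u i‖ ^ 2) * Real.sqrt (∑ i, ‖w i‖ ^ 2) := by ring

/-! ### The gap as an operator inequality -/

/-- **The spectral gap as an operator inequality**: for Hermitian `H` there is `g > 0` with
`H - E₀ - g(1 - P₀) ≥ 0`, `P₀` the ground projection. In the eigenbasis both sides are diagonal;
`g` is the distance from `E₀` to the other eigenvalues (or `1` if there are none). Kato,
*Perturbation theory*, §I.5; Tasaki (2020) App. A. [folklore] -/
theorem exists_gap_posSemidef {H : Matrix m m ℂ} (hH : H.IsHermitian) :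
    ∃ g : ℝ, 0 < g ∧
      (H - (H.groundEnergy : ℂ) • (1 : Matrix m m ℂ) -
        (g : ℂ) • ((1 : Matrix m m ℂ) - H.groundProj)).PosSemidef := by
  have hcoe : (RCLike.ofReal ∘ hH.eigenvalues : m → ℂ) = fun i => ((hH.eigenvalues i : ℝ) : ℂ) := by
    funext i; rfl
  have hspec : H = (hH.eigenvectorUnitary : Matrix m m ℂ) *
      diagonal (fun i => ((hH.eigenvalues i : ℝ) : ℂ)) * star (hH.eigenvectorUnitary : Matrix m m ℂ) := by
    have := hH.spectral_theorem
    rw [Unitary.conjStarAlgAut_apply, hcoe] at this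
    exact this
  have hP := hH.groundProj_eq_conj_diagonal
  have hUU : (hH.eigenvectorUnitary : Matrix m m ℂ) * star (hH.eigenvectorUnitary : Matrix m m ℂ) =
      1 := Unitary.mul_star_self_of_mem hH.eigenvectorUnitary.prop
  set U : Matrix m m ℂ := (hH.eigenvectorUnitary : Matrix m m ℂ) with hU
  set E₀ := H.groundEnergy with hE₀
  -- the gap
  set S := (univ : Finset m).filter fun i => hH.eigenvalues i ≠ E₀ with hS
  obtain ⟨g, hg, hgle⟩ : ∃ g : ℝ, 0 < g ∧ ∀ i ∈ S, g ≤ hH.eigenvalues i - E₀ := by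
    by_cases hne : S.Nonempty
    · refine ⟨S.inf' hne fun i => hH.eigenvalues i - E₀, ?_, fun i hi => inf'_le _ hi⟩
      obtain ⟨i₀, hi₀, h⟩ := exists_mem_eq_inf' hne (fun i => hH.eigenvalues i - E₀)
      rw [h]
      have h1 : E₀ ≤ hH.eigenvalues i₀ := groundEnergy_le_eigenvalues hH i₀
      have h2 : hH.eigenvalues i₀ ≠ E₀ := (mem_filter.1 hi₀).2
      exact sub_pos.2 (lt_of_le_of_ne h1 (Ne.symm h2))
    · exact ⟨1, one_pos, fun i hi => (hne ⟨i, hi⟩).elim⟩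
  refine ⟨g, hg, ?_⟩
  -- both sides are diagonal in the eigenbasis
  set ind : m → ℂ := fun i => if hH.eigenvalues i = E₀ then (1 : ℂ) else 0 with hind
  set f : m → ℝ := fun i =>
    hH.eigenvalues i - E₀ - g * (if hH.eigenvalues i = E₀ then 0 else 1) with hf
  have hdiag : diagonal (fun i => ((f i : ℝ) : ℂ)) =
      diagonal (fun i => ((hH.eigenvalues i : ℝ) : ℂ)) - (E₀ : ℂ) • (1 : Matrix m m ℂ) -
        (g : ℂ) • ((1 : Matrix m m ℂ) - diagonal ind) := by
    ext i j
    by_cases hij : i = j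
    · subst hij
      simp only [diagonal_apply_eq, Matrix.sub_apply, Matrix.smul_apply, Matrix.one_apply_eq,
        smul_eq_mul, mul_one, hf, hind]
      split_ifs <;> push_cast <;> ring
    · simp only [diagonal_apply_ne _ hij, Matrix.sub_apply, Matrix.smul_apply,
        Matrix.one_apply_ne hij, smul_eq_mul, mul_zero, sub_zero]
  have hform : H - (E₀ : ℂ) • (1 : Matrix m m ℂ) - (g : ℂ) • ((1 : Matrix m m ℂ) - H.groundProj) =
      U * diagonal (fun i => ((f i : ℝ) : ℂ)) * star U := by
    rw [hdiag, Matrix.mul_sub, Matrix.mul_sub, Matrix.sub_mul, Matrix.sub_mul, Matrix.mul_smul,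
      Matrix.smul_mul, Matrix.mul_one, hUU, Matrix.mul_smul, Matrix.smul_mul, Matrix.mul_sub,
      Matrix.sub_mul, Matrix.mul_one, hUU, ← hspec, ← hP]
  rw [hform, star_eq_conjTranspose]
  refine PosSemidef.mul_mul_conjTranspose_same ?_ U
  rw [posSemidef_diagonal_iff]
  intro i
  have hfi : 0 ≤ f i := by
    simp only [hf]
    split_ifs with h
    · rw [h]; simp
    · have := hgle i (mem_filter.2 ⟨mem_univ i, h⟩)
      linarith
  exact_mod_cast hfi

/-! ### The second-order lower bound -/

/-- **Second-order stability of the ground energy under a ground-space-blind perturbation.**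
Let `H` be Hermitian, `D = diag(x)` real with `|xᵢ| ≤ B`, and `⟨v, D v⟩ = 0` for every ground
vector `v` of `H`. Then there is `C ≥ 0` with `E₀(H) - C μ² ≤ E₀(H - μ D)` for all real `μ`
(first-order perturbation theory of the degenerate ground level: the first-order shift is the
spectrum of `P₀ D P₀ = 0`). Kato, *Perturbation theory for linear operators*, §II.2;
Reed–Simon IV, Thm XII.5. [folklore] -/
theorem le_groundEnergy_sub_smul_diagonal [Nonempty m] {H : Matrix m m ℂ} (hH : H.IsHermitian)
    (x : m → ℝ) {B : ℝ} (hB : ∀ i, |x i| ≤ B)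
    (horth : ∀ v ∈ H.groundSpace, star v ⬝ᵥ (diagonal (fun i => ((x i : ℝ) : ℂ)) *ᵥ v) = 0) :
    ∃ C : ℝ, 0 ≤ C ∧ ∀ μ : ℝ,
      H.groundEnergy - C * μ ^ 2 ≤
        (H - (μ : ℂ) • diagonal (fun i => ((x i : ℝ) : ℂ))).groundEnergy := by
  obtain ⟨g, hg, hpsd⟩ := exists_gap_posSemidef hH
  have hB0 : 0 ≤ B := (abs_nonneg _).trans (hB (Classical.arbitrary m))
  refine ⟨9 * B ^ 2 / (4 * g), by positivity, fun μ => ?_⟩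
  set D : Matrix m m ℂ := diagonal (fun i => ((x i : ℝ) : ℂ)) with hD
  set P := H.groundProj with hPdef
  set E₀ := H.groundEnergy with hE₀
  have hDh : D.IsHermitian := by
    rw [hD, IsHermitian, diagonal_conjTranspose]
    congr 1
    funext i
    simp [Complex.conj_ofReal]
  have hKh : (H - (μ : ℂ) • D).IsHermitian := by
    refine hH.sub ?_
    rw [IsHermitian, conjTranspose_smul, hDh.eq]
    simp [Complex.conj_ofReal]
  obtain ⟨φ, hφ1, hφE⟩ := Matrix.exists_groundState_unit hKh
  rw [← hφE, sub_mulVec, smul_mulVec, dotProduct_sub, dotProduct_smul, Complex.sub_re, smul_eq_mul,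
    Complex.re_ofReal_mul]
  -- the splitting `φ = u + w`, `u = P φ`
  set u := P *ᵥ φ with hu
  set w := φ - u with hw
  have hφuw : φ = u + w := by rw [hw]; abel
  have hPh : Pᴴ = P := (groundProj_isHermitian H).eq
  have humem : u ∈ H.groundSpace := groundProj_mulVec_mem H φ
  have hPu : P *ᵥ u = u := groundProj_mulVec_of_mem H humem
  have hPw : P *ᵥ w = 0 := by rw [hw, mulVec_sub, hPu, ← hu, sub_self]
  have huw : star u ⬝ᵥ w = 0 := by
    rw [hu, star_mulVec, ← dotProduct_mulVec, hPh, hPw, dotProduct_zero]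
  have hwu : star w ⬝ᵥ u = 0 := by
    have := congrArg star huw
    rwa [star_dotProduct, star_star, star_zero] at this
  -- norms
  have hnorm : (star u ⬝ᵥ u).re + (star w ⬝ᵥ w).re = 1 := by
    have h := congrArg Complex.re hφ1
    rw [hφuw, star_add, add_dotProduct, dotProduct_add, dotProduct_add, huw, hwu] at h
    simpa using h
  have hnu0 : 0 ≤ (star u ⬝ᵥ u).re := by rw [RayleighBottom.re_star_dotProduct_self]; positivity
  have hnw0 : 0 ≤ (star w ⬝ᵥ w).re := by rw [RayleighBottom.re_star_dotProduct_self]; positivity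
  set t := Real.sqrt ((star w ⬝ᵥ w).re) with ht
  have ht0 : 0 ≤ t := Real.sqrt_nonneg _
  have ht2 : t ^ 2 = (star w ⬝ᵥ w).re := Real.sq_sqrt hnw0
  have ht1 : t ≤ 1 := by
    rw [ht, Real.sqrt_le_one]
    linarith
  have hsu1 : Real.sqrt ((star u ⬝ᵥ u).re) ≤ 1 := by
    rw [Real.sqrt_le_one]
    linarith
  -- (1) the gap inequality: `Re⟨φ,Hφ⟩ ≥ E₀ + g t²`
  have hgap : E₀ + g * t ^ 2 ≤ (star φ ⬝ᵥ H *ᵥ φ).re := by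
    have h := hpsd.dotProduct_mulVec_nonneg φ
    rw [sub_mulVec, sub_mulVec, smul_mulVec, smul_mulVec, one_mulVec, sub_mulVec, one_mulVec,
      dotProduct_sub, dotProduct_sub, dotProduct_smul, dotProduct_smul, dotProduct_sub, hφ1] at h
    obtain ⟨hre, -⟩ := Complex.nonneg_iff.mp h
    rw [Complex.sub_re, Complex.sub_re, smul_eq_mul, smul_eq_mul, mul_one, Complex.ofReal_re,
      Complex.re_ofReal_mul, Complex.sub_re, Complex.one_re] at hre
    -- `⟨φ, P φ⟩ = ⟨u + w, u⟩ = ⟨u, u⟩`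
    have hPφ : (star φ ⬝ᵥ P *ᵥ φ).re = (star u ⬝ᵥ u).re := by
      rw [← hu, hφuw, star_add, add_dotProduct, hwu, add_zero]
    rw [hPφ] at hre
    have hw1 : (star w ⬝ᵥ w).re = 1 - (star u ⬝ᵥ u).re := by linarith
    rw [ht2, hw1]
    linarith
  -- (2) the blindness: `|Re⟨φ, D φ⟩| ≤ 3 B t`
  have hblind : |(star φ ⬝ᵥ D *ᵥ φ).re| ≤ 3 * B * t := by
    have huu : star u ⬝ᵥ D *ᵥ u = 0 := horth u humem
    have hexp : star φ ⬝ᵥ D *ᵥ φ = star u ⬝ᵥ D *ᵥ w + star w ⬝ᵥ D *ᵥ u + star w ⬝ᵥ D *ᵥ w := by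
      rw [hφuw, star_add, mulVec_add, add_dotProduct, dotProduct_add, dotProduct_add, huu, zero_add,
        add_assoc]
    have h1 : ‖star u ⬝ᵥ D *ᵥ w‖ ≤ B * t := by
      refine (norm_dotProduct_diagonal_mulVec_le x hB u w).trans ?_
      rw [← ht]
      calc B * Real.sqrt ((star u ⬝ᵥ u).re) * t ≤ B * 1 * t := by gcongr
        _ = B * t := by ring
    have h2 : ‖star w ⬝ᵥ D *ᵥ u‖ ≤ B * t := by
      refine (norm_dotProduct_diagonal_mulVec_le x hB w u).trans ?_
      rw [← ht]
      calc B * t * Real.sqrt ((star u ⬝ᵥ u).re) ≤ B * t * 1 := by gcongr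
        _ = B * t := by ring
    have h3 : ‖star w ⬝ᵥ D *ᵥ w‖ ≤ B * t := by
      refine (norm_dotProduct_diagonal_mulVec_le x hB w w).trans ?_
      rw [← ht]
      calc B * t * t ≤ B * t * 1 := by gcongr
        _ = B * t := by ring
    calc |(star φ ⬝ᵥ D *ᵥ φ).re| ≤ ‖star φ ⬝ᵥ D *ᵥ φ‖ := Complex.abs_re_le_norm _
      _ ≤ ‖star u ⬝ᵥ D *ᵥ w‖ + ‖star w ⬝ᵥ D *ᵥ u‖ + ‖star w ⬝ᵥ D *ᵥ w‖ := by
          rw [hexp]; exact norm_add₃_le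
      _ ≤ B * t + B * t + B * t := by gcongr
      _ = 3 * B * t := by ring
  -- (3) conclude: `g t² - 3|μ| B t ≥ -9 μ² B² / (4 g)`
  have hμD : μ * (star φ ⬝ᵥ D *ᵥ φ).re ≤ |μ| * (3 * B * t) := by
    calc μ * (star φ ⬝ᵥ D *ᵥ φ).re ≤ |μ * (star φ ⬝ᵥ D *ᵥ φ).re| := le_abs_self _
      _ = |μ| * |(star φ ⬝ᵥ D *ᵥ φ).re| := abs_mul _ _
      _ ≤ |μ| * (3 * B * t) := mul_le_mul_of_nonneg_left hblind (abs_nonneg μ)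
  have hsq : 0 ≤ g * (t - 3 * |μ| * B / (2 * g)) ^ 2 := by positivity
  have hexpand : g * (t - 3 * |μ| * B / (2 * g)) ^ 2 =
      g * t ^ 2 - |μ| * (3 * B * t) + 9 * B ^ 2 / (4 * g) * |μ| ^ 2 := by
    field_simp
    ring
  rw [hexpand, sq_abs] at hsq
  linarith

end Summit.HubbardSuperconductivity.HubbardSuperconductivity.Theorems.AnisotropyChord
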